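import Summits.AnomalousDissipation.AnomalousDissipation.Theorems.SawtoothPulseCascadeK1LocalisedCascadePhaseBudgetCellsB

/-!
# K2 lane (route-2 `SawtoothPulseCascade`, crux dir `K1LocalisedCascade`): THE PHASE BUDGET LEMMA (S1 of line `bellman-weight`)

`phaseBudget`: for every lattice class `(α, β) ∈ [0, ½]²` the modal Kelvin–Helmholtz rates of the two slots of a phase of the sharp
sawtooth cascade add up to at most `σ⋆ = sawSigmaStar = 0.30982`:

  `max (σ(α,β)) (σ(1−α,β)) + max (σ(β,α)) (σ(1−β,α)) ≤ σ⋆`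

(`σ = sawSigma`; this is planner p4 g14's `Cruxes/K1LocalisedCascade/K2ControlSketch.lean :: PhaseBudget` unfolded, there
certified by ball arithmetic, kit j319236; here a kernel proof). So the modal factor of the K2 cap is ONE e-folding set `e^{γσ⋆}` per
PHASE, class-free — necessary content of any proof of `K2PhaseGrowthClassicalH ⟨8,δ₀,2,1,2⟩ 5` (cap `5e^{8σ⋆} = 59.6 < e^{16σ⋆} = 142`).
Architecture (by symmetry `α ≤ β`): `σ(α,β) = 0` (diagonal cut-off `sawSigma_eq_zero_of_le`); `α ≤ ¼ ⇒ σ(1−α,β) = 0`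
(`sigma_wrapped_eq_zero_of_le_quarter`: `cos πβ ≤ cos πα ≤ −D(π(1−α))`, two certified values of `D`); `σ(β,α) > 0 ⇒ σ(1−α,β) = 0`
(`sigma_wrapped_eq_zero_of_unwrapped_pos`: a five-step bootstrap between the thresholds `cos πα > D(πβ)` and `cos πβ > −D(π(1−α))`);
and on `[¼,½]²` the wrapped–wrapped sum `σ(1−α,β) + σ(1−β,α)` is bounded cell by cell on the dyadic grid
`{1/4, 9/32, 5/16, 11/32, 3/8, 7/16, 1/2}` (`ww_bound` over the 36 `cell_i_j`, worst cell total 0.2730 < 0.30982; true maximum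
`0.2121` at `(0.354, 0.354)`). Case tree generated (seat folder `work/gen_assembly.py`). No definitions.
[cite: Drazin2002, §8.3 (8.36)–(8.38) and Exercise 8.10 (broken-line Rayleigh data behind `sawSigma`)] [problem: turb]
-/

-- `Summit.<Summit>.<Problem>`: single-conjunct summit, the duplicate namespace segment is deliberate.
set_option linter.dupNamespace false

noncomputable section

namespace Summit.AnomalousDissipation.AnomalousDissipation.Theorems.SawtoothPulseCascade.K2PhaseBudget

open Set Real Literature.Analysis.FluidPDE.SawtoothCascade

/-! ## §1 The wrapped–wrapped square `[¼, ½]²` -/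

/-- **Wrapped–wrapped bound.** For `a, b ∈ [¼, ½]`: `σ(1−a, b) + σ(1−b, a) ≤ σ⋆` (36 cells; worst total 0.2730). [folklore] -/
theorem ww_bound {a b : ℝ} (ha1 : 1 / 4 ≤ a) (ha2 : a ≤ 1 / 2) (hb1 : 1 / 4 ≤ b) (hb2 : b ≤ 1 / 2) :
    sawSigma (1 - a) b + sawSigma (1 - b) a ≤ sawSigmaStar := by
  have hσ : sawSigmaStar = 0.30982 := rfl
  rw [hσ]
  rcases le_or_gt a (9 / 32 : ℝ) with hau0 | hal0
  · rcases le_or_gt b (9 / 32 : ℝ) with hbu0 | hbl0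
    · exact (add_le_add (cell_0_0 ha1 hau0 hb1 hb2) (cell_0_0 hb1 hbu0 ha1 ha2)).trans (by norm_num)
    rcases le_or_gt b (5 / 16 : ℝ) with hbu1 | hbl1
    · exact (add_le_add (cell_0_1 ha1 hau0 hbl0.le hb2) (cell_1_0 hbl0.le hbu1 ha1 ha2)).trans (by norm_num)
    rcases le_or_gt b (11 / 32 : ℝ) with hbu2 | hbl2
    · exact (add_le_add (cell_0_2 ha1 hau0 hbl1.le hb2) (cell_2_0 hbl1.le hbu2 ha1 ha2)).trans (by norm_num)
    rcases le_or_gt b (3 / 8 : ℝ) with hbu3 | hbl3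
    · exact (add_le_add (cell_0_3 ha1 hau0 hbl2.le hb2) (cell_3_0 hbl2.le hbu3 ha1 ha2)).trans (by norm_num)
    rcases le_or_gt b (7 / 16 : ℝ) with hbu4 | hbl4
    · exact (add_le_add (cell_0_4 ha1 hau0 hbl3.le hb2) (cell_4_0 hbl3.le hbu4 ha1 ha2)).trans (by norm_num)
    exact (add_le_add (cell_0_5 ha1 hau0 hbl4.le hb2) (cell_5_0 hbl4.le hb2 ha1 ha2)).trans (by norm_num)
  rcases le_or_gt a (5 / 16 : ℝ) with hau1 | hal1
  · rcases le_or_gt b (9 / 32 : ℝ) with hbu0 | hbl0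
    · exact (add_le_add (cell_1_0 hal0.le hau1 hb1 hb2) (cell_0_1 hb1 hbu0 hal0.le ha2)).trans (by norm_num)
    rcases le_or_gt b (5 / 16 : ℝ) with hbu1 | hbl1
    · exact (add_le_add (cell_1_1 hal0.le hau1 hbl0.le hb2) (cell_1_1 hbl0.le hbu1 hal0.le ha2)).trans (by norm_num)
    rcases le_or_gt b (11 / 32 : ℝ) with hbu2 | hbl2
    · exact (add_le_add (cell_1_2 hal0.le hau1 hbl1.le hb2) (cell_2_1 hbl1.le hbu2 hal0.le ha2)).trans (by norm_num)
    rcases le_or_gt b (3 / 8 : ℝ) with hbu3 | hbl3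
    · exact (add_le_add (cell_1_3 hal0.le hau1 hbl2.le hb2) (cell_3_1 hbl2.le hbu3 hal0.le ha2)).trans (by norm_num)
    rcases le_or_gt b (7 / 16 : ℝ) with hbu4 | hbl4
    · exact (add_le_add (cell_1_4 hal0.le hau1 hbl3.le hb2) (cell_4_1 hbl3.le hbu4 hal0.le ha2)).trans (by norm_num)
    exact (add_le_add (cell_1_5 hal0.le hau1 hbl4.le hb2) (cell_5_1 hbl4.le hb2 hal0.le ha2)).trans (by norm_num)
  rcases le_or_gt a (11 / 32 : ℝ) with hau2 | hal2
  · rcases le_or_gt b (9 / 32 : ℝ) with hbu0 | hbl0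
    · exact (add_le_add (cell_2_0 hal1.le hau2 hb1 hb2) (cell_0_2 hb1 hbu0 hal1.le ha2)).trans (by norm_num)
    rcases le_or_gt b (5 / 16 : ℝ) with hbu1 | hbl1
    · exact (add_le_add (cell_2_1 hal1.le hau2 hbl0.le hb2) (cell_1_2 hbl0.le hbu1 hal1.le ha2)).trans (by norm_num)
    rcases le_or_gt b (11 / 32 : ℝ) with hbu2 | hbl2
    · exact (add_le_add (cell_2_2 hal1.le hau2 hbl1.le hb2) (cell_2_2 hbl1.le hbu2 hal1.le ha2)).trans (by norm_num)
    rcases le_or_gt b (3 / 8 : ℝ) with hbu3 | hbl3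
    · exact (add_le_add (cell_2_3 hal1.le hau2 hbl2.le hb2) (cell_3_2 hbl2.le hbu3 hal1.le ha2)).trans (by norm_num)
    rcases le_or_gt b (7 / 16 : ℝ) with hbu4 | hbl4
    · exact (add_le_add (cell_2_4 hal1.le hau2 hbl3.le hb2) (cell_4_2 hbl3.le hbu4 hal1.le ha2)).trans (by norm_num)
    exact (add_le_add (cell_2_5 hal1.le hau2 hbl4.le hb2) (cell_5_2 hbl4.le hb2 hal1.le ha2)).trans (by norm_num)
  rcases le_or_gt a (3 / 8 : ℝ) with hau3 | hal3
  · rcases le_or_gt b (9 / 32 : ℝ) with hbu0 | hbl0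
    · exact (add_le_add (cell_3_0 hal2.le hau3 hb1 hb2) (cell_0_3 hb1 hbu0 hal2.le ha2)).trans (by norm_num)
    rcases le_or_gt b (5 / 16 : ℝ) with hbu1 | hbl1
    · exact (add_le_add (cell_3_1 hal2.le hau3 hbl0.le hb2) (cell_1_3 hbl0.le hbu1 hal2.le ha2)).trans (by norm_num)
    rcases le_or_gt b (11 / 32 : ℝ) with hbu2 | hbl2
    · exact (add_le_add (cell_3_2 hal2.le hau3 hbl1.le hb2) (cell_2_3 hbl1.le hbu2 hal2.le ha2)).trans (by norm_num)
    rcases le_or_gt b (3 / 8 : ℝ) with hbu3 | hbl3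
    · exact (add_le_add (cell_3_3 hal2.le hau3 hbl2.le hb2) (cell_3_3 hbl2.le hbu3 hal2.le ha2)).trans (by norm_num)
    rcases le_or_gt b (7 / 16 : ℝ) with hbu4 | hbl4
    · exact (add_le_add (cell_3_4 hal2.le hau3 hbl3.le hb2) (cell_4_3 hbl3.le hbu4 hal2.le ha2)).trans (by norm_num)
    exact (add_le_add (cell_3_5 hal2.le hau3 hbl4.le hb2) (cell_5_3 hbl4.le hb2 hal2.le ha2)).trans (by norm_num)
  rcases le_or_gt a (7 / 16 : ℝ) with hau4 | hal4
  · rcases le_or_gt b (9 / 32 : ℝ) with hbu0 | hbl0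
    · exact (add_le_add (cell_4_0 hal3.le hau4 hb1 hb2) (cell_0_4 hb1 hbu0 hal3.le ha2)).trans (by norm_num)
    rcases le_or_gt b (5 / 16 : ℝ) with hbu1 | hbl1
    · exact (add_le_add (cell_4_1 hal3.le hau4 hbl0.le hb2) (cell_1_4 hbl0.le hbu1 hal3.le ha2)).trans (by norm_num)
    rcases le_or_gt b (11 / 32 : ℝ) with hbu2 | hbl2
    · exact (add_le_add (cell_4_2 hal3.le hau4 hbl1.le hb2) (cell_2_4 hbl1.le hbu2 hal3.le ha2)).trans (by norm_num)
    rcases le_or_gt b (3 / 8 : ℝ) with hbu3 | hbl3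
    · exact (add_le_add (cell_4_3 hal3.le hau4 hbl2.le hb2) (cell_3_4 hbl2.le hbu3 hal3.le ha2)).trans (by norm_num)
    rcases le_or_gt b (7 / 16 : ℝ) with hbu4 | hbl4
    · exact (add_le_add (cell_4_4 hal3.le hau4 hbl3.le hb2) (cell_4_4 hbl3.le hbu4 hal3.le ha2)).trans (by norm_num)
    exact (add_le_add (cell_4_5 hal3.le hau4 hbl4.le hb2) (cell_5_4 hbl4.le hb2 hal3.le ha2)).trans (by norm_num)
  rcases le_or_gt b (9 / 32 : ℝ) with hbu0 | hbl0
  · exact (add_le_add (cell_5_0 hal4.le ha2 hb1 hb2) (cell_0_5 hb1 hbu0 hal4.le ha2)).trans (by norm_num)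
  rcases le_or_gt b (5 / 16 : ℝ) with hbu1 | hbl1
  · exact (add_le_add (cell_5_1 hal4.le ha2 hbl0.le hb2) (cell_1_5 hbl0.le hbu1 hal4.le ha2)).trans (by norm_num)
  rcases le_or_gt b (11 / 32 : ℝ) with hbu2 | hbl2
  · exact (add_le_add (cell_5_2 hal4.le ha2 hbl1.le hb2) (cell_2_5 hbl1.le hbu2 hal4.le ha2)).trans (by norm_num)
  rcases le_or_gt b (3 / 8 : ℝ) with hbu3 | hbl3
  · exact (add_le_add (cell_5_3 hal4.le ha2 hbl2.le hb2) (cell_3_5 hbl2.le hbu3 hal4.le ha2)).trans (by norm_num)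
  rcases le_or_gt b (7 / 16 : ℝ) with hbu4 | hbl4
  · exact (add_le_add (cell_5_4 hal4.le ha2 hbl3.le hb2) (cell_4_5 hbl3.le hbu4 hal4.le ha2)).trans (by norm_num)
  exact (add_le_add (cell_5_5 hal4.le ha2 hbl4.le hb2) (cell_5_5 hbl4.le hb2 hal4.le ha2)).trans (by norm_num)

/-! ## §2 The unwrapped/wrapped exclusions -/

/-- `α ≤ ¼`, `α ≤ β ≤ ½` ⇒ the wrapped H-line `1 − α` is stable at Bloch phase `β`: `σ(1−α, β) = 0`
(`cos πβ ≤ cos πα ≤ −D(π(1−α))`; two certified values of `D`). [folklore] -/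
theorem sigma_wrapped_eq_zero_of_le_quarter {α β : ℝ} (hα0 : 0 ≤ α) (hα : α ≤ 1 / 4) (hαβ : α ≤ β)
    (hβ : β ≤ 1 / 2) : sawSigma (1 - α) β = 0 := by
  have hπlo := Real.pi_gt_d6
  have hπ0 := Real.pi_pos
  have hk : 0 < 1 - α := by linarith
  apply sawSigma_eq_zero_of_cos_sq_le hk
  have hx0 : 0 < π * (1 - α) := mul_pos hπ0 hk
  have hcβ0 : 0 ≤ Real.cos (π * β) := cos_pi_mul_nonneg (hα0.trans hαβ) hβ
  have hcβα : Real.cos (π * β) ≤ Real.cos (π * α) := cos_pi_mul_le_cos_pi_mul hα0 hαβ (by linarith)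
  -- `cos πα ≤ −D(π(1−α))`
  have hneg : Real.cos (π * α) ≤ -(2 * Real.sinh (π * (1 - α)) / (π * (1 - α)) - Real.cosh (π * (1 - α))) := by
    rcases le_or_gt α (1 / 5) with h5 | h5
    · -- `π(1−α) ≥ π·4/5 > C1XLO`: `−D ≥ 1.33 ≥ 1 ≥ cos`
      have hxw : (2513273 / 1000000 : ℝ) ≤ π * (1 - α) := by
        have h1 : (2513273 / 1000000 : ℝ) ≤ 3.141592 * (1 - 1 / 5) := by norm_num
        have h2 : 3.141592 * (1 - 1 / 5) ≤ π * (1 - 1 / 5) := mul_le_mul_of_nonneg_right hπlo.le (by norm_num)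
        have h3 : π * (1 - 1 / 5) ≤ π * (1 - α) := mul_le_mul_of_nonneg_left (by linarith) hπ0.le
        linarith
      have hD : 2 * Real.sinh (π * (1 - α)) / (π * (1 - α)) - Real.cosh (π * (1 - α)) ≤ (-166667 / 125000 : ℝ) :=
        (khD_le_khD (by norm_num) hxw).trans (pt_c1 (2513273 / 1000000 : ℝ) ⟨le_refl _, le_refl _⟩).2.2.2.2.2
      have : Real.cos (π * α) ≤ 1 := Real.cos_le_one _
      linarith
    · -- `π(1−α) ≥ π·3/4 > G0XLO`: `−D ≥ 0.885 ≥ cos(π/5) ≥ cos πα`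
      have hxw : (1178097 / 500000 : ℝ) ≤ π * (1 - α) := by
        have h1 : (1178097 / 500000 : ℝ) ≤ 3.141592 * (1 - 1 / 4) := by norm_num
        have h2 : 3.141592 * (1 - 1 / 4) ≤ π * (1 - 1 / 4) := mul_le_mul_of_nonneg_right hπlo.le (by norm_num)
        have h3 : π * (1 - 1 / 4) ≤ π * (1 - α) := mul_le_mul_of_nonneg_left (by linarith) hπ0.le
        linarith
      have hD : 2 * Real.sinh (π * (1 - α)) / (π * (1 - α)) - Real.cosh (π * (1 - α)) ≤ (-177021 / 200000 : ℝ) :=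
        (khD_le_khD (by norm_num) hxw).trans (pt_g0 (1178097 / 500000 : ℝ) ⟨le_refl _, by norm_num⟩).2.2.2.2.2
      have hc5 : Real.cos (π * α) ≤ Real.cos (π * (1 / 5 : ℝ)) :=
        cos_pi_mul_le_cos_pi_mul (by norm_num) h5.le (by linarith)
      have := cospi_fifth
      linarith
  have h1 : Real.cos (π * β) ≤ -(2 * Real.sinh (π * (1 - α)) / (π * (1 - α)) - Real.cosh (π * (1 - α))) :=
    hcβα.trans hneg
  calc Real.cos (π * β) ^ 2 ≤ (-(2 * Real.sinh (π * (1 - α)) / (π * (1 - α)) - Real.cosh (π * (1 - α)))) ^ 2 :=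
        pow_le_pow_left₀ hcβ0 h1 2
    _ = (2 * Real.sinh (π * (1 - α)) / (π * (1 - α)) - Real.cosh (π * (1 - α))) ^ 2 := by ring

/-- If `cos u₁ ≤ c ≤ d < cos u` with `0 ≤ u₁`, `u ≤ π`, then `u < u₁` (contrapositive of the monotonicity of `cos` on `[0, π]`). [folklore] -/
theorem lt_of_cos_lt_cos_bound {u u₁ c d : ℝ} (hu0 : 0 ≤ u₁) (huπ : u ≤ π) (hc : Real.cos u₁ ≤ c) (hcd : c ≤ d)
    (hd : d < Real.cos u) : u < u₁ := by
  by_contra hge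
  have : Real.cos u ≤ Real.cos u₁ := Real.cos_le_cos_of_nonneg_of_le_pi hu0 huπ (not_lt.1 hge)
  linarith

/-- `α, β ∈ [¼, ½]` and the unwrapped V-line `β` unstable at Bloch phase `α` ⇒ the wrapped H-line `1 − α` is stable at phase `β`:
`σ(β,α) > 0 ⇒ σ(1−α,β) = 0`. Bootstrap between `cos πα > D(πβ)` and `cos πβ > −D(π(1−α))` through the certified thresholds
`D(π/2) ≥ 0.4209 ⇒ πα < 1.137 ⇒ −D(π−πα) ≥ 0.143 ⇒ πβ < 1.428 ⇒ D(πβ) ≥ 0.547 ⇒ πα < 0.992 ⇒ −D ≥ 0.411 ⇒ πβ < 1.148 ⇒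
D(πβ) ≥ 0.734 > cos(π/4) ≥ cos πα`, contradiction. [folklore] -/
theorem sigma_wrapped_eq_zero_of_unwrapped_pos {α β : ℝ} (hα1 : 1 / 4 ≤ α) (hα2 : α ≤ 1 / 2) (hβ1 : 1 / 4 ≤ β)
    (hβ2 : β ≤ 1 / 2) (hpos : 0 < sawSigma β α) : sawSigma (1 - α) β = 0 := by
  have hπlo := Real.pi_gt_d6
  have hπhi := Real.pi_lt_d6
  have hπ0 := Real.pi_pos
  by_contra hne
  have hpos' : 0 < sawSigma (1 - α) β :=
    lt_of_le_of_ne (sawSigma_nonneg (by linarith) β) (Ne.symm hne)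
  have hu0 : 0 < π * α := by positivity
  have hv0 : 0 < π * β := by positivity
  have huπ : π * α ≤ π := by
    have := mul_le_mul_of_nonneg_left (show α ≤ 1 by linarith) hπ0.le; linarith
  have hvπ : π * β ≤ π := by
    have := mul_le_mul_of_nonneg_left (show β ≤ 1 by linarith) hπ0.le; linarith
  have hcu0 : 0 ≤ Real.cos (π * α) := cos_pi_mul_nonneg (by linarith) hα2
  have hcv0 : 0 ≤ Real.cos (π * β) := cos_pi_mul_nonneg (by linarith) hβ2
  -- cond1: `D(πβ) < cos (πα)`
  have h1 := sq_lt_cos_sq_of_sawSigma_pos (by linarith) hpos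
  have cond1 : 2 * Real.sinh (π * β) / (π * β) - Real.cosh (π * β) < Real.cos (π * α) :=
    lt_of_le_of_lt (le_abs_self _) (abs_lt_of_sq_lt_sq h1 hcu0)
  -- cond2: `−D(π − πα) < cos (πβ)` (`π(1−α) = π − πα`)
  have h2 := sq_lt_cos_sq_of_sawSigma_pos (by linarith) hpos'
  have e : π * (1 - α) = π - π * α := by ring
  rw [e] at h2
  have cond2 : -(2 * Real.sinh (π - π * α) / (π - π * α) - Real.cosh (π - π * α)) < Real.cos (π * β) :=
    lt_of_le_of_lt (neg_le_abs _) (abs_lt_of_sq_lt_sq h2 hcv0)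
  -- step 0: `D(πβ) ≥ D(π/2) ≥ G6DLO`
  have hvpi : π * β ≤ π / 2 := pi_mul_le_pi_div_two hβ2
  have hD0 : (420921 / 1000000 : ℝ) ≤ 2 * Real.sinh (π * β) / (π * β) - Real.cosh (π * β) :=
    (pt_g6 (π / 2) ⟨by linarith, by linarith⟩).2.2.2.2.1.trans (khD_le_khD hv0 hvpi)
  -- ⇒ `πα < 1.137`
  have hu1 : π * α < (1137 / 1000 : ℝ) :=
    lt_of_cos_lt_cos_bound (d := (420921 / 1000000 : ℝ)) (by norm_num) huπ cosr_u1 (by norm_num) (by linarith)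
  -- ⇒ `−D(π − πα) ≥ −(W1DHI)`
  have hw1 : (125287 / 62500 : ℝ) ≤ π - π * α := by linarith
  have hE1 : 2 * Real.sinh (π - π * α) / (π - π * α) - Real.cosh (π - π * α) ≤ (-143061 / 1000000 : ℝ) :=
    (khD_le_khD (by norm_num) hw1).trans (pt_w1 (125287 / 62500 : ℝ) ⟨le_refl _, le_refl _⟩).2.2.2.2.2
  -- ⇒ `πβ < 1.428`
  have hv1 : π * β < (357 / 250 : ℝ) :=
    lt_of_cos_lt_cos_bound (d := -(-143061 / 1000000 : ℝ)) (by norm_num) hvπ cosr_v1 (by norm_num) (by linarith)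
  -- ⇒ `D(πβ) ≥ D(1.428) ≥ V1DLO`
  have hD1 : (17107 / 31250 : ℝ) ≤ 2 * Real.sinh (π * β) / (π * β) - Real.cosh (π * β) :=
    (pt_v1 (357 / 250 : ℝ) ⟨le_refl _, le_refl _⟩).2.2.2.2.1.trans (khD_le_khD hv0 hv1.le)
  -- ⇒ `πα < 0.992`
  have hu2 : π * α < (124 / 125 : ℝ) :=
    lt_of_cos_lt_cos_bound (d := (17107 / 31250 : ℝ)) (by norm_num) huπ cosr_u2 (by norm_num) (by linarith)
  -- ⇒ `−D(π − πα) ≥ −(W2DHI)`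
  have hw2 : (268699 / 125000 : ℝ) ≤ π - π * α := by linarith
  have hE2 : 2 * Real.sinh (π - π * α) / (π - π * α) - Real.cosh (π - π * α) ≤ (-102767 / 250000 : ℝ) :=
    (khD_le_khD (by norm_num) hw2).trans (pt_w2 (268699 / 125000 : ℝ) ⟨le_refl _, le_refl _⟩).2.2.2.2.2
  -- ⇒ `πβ < 1.148`
  have hv2 : π * β < (287 / 250 : ℝ) :=
    lt_of_cos_lt_cos_bound (d := -(-102767 / 250000 : ℝ)) (by norm_num) hvπ cosr_v2 (by norm_num) (by linarith)
  -- ⇒ `D(πβ) ≥ V2DLO > cos (π/4) ≥ cos (πα)`: contradiction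
  have hD2 : (734597 / 1000000 : ℝ) ≤ 2 * Real.sinh (π * β) / (π * β) - Real.cosh (π * β) :=
    (pt_v2 (287 / 250 : ℝ) ⟨le_refl _, le_refl _⟩).2.2.2.2.1.trans (khD_le_khD hv0 hv2.le)
  have hcu : Real.cos (π * α) ≤ Real.cos (π * (1 / 4 : ℝ)) := cos_pi_mul_le_cos_pi_mul (by norm_num) hα1 (by linarith)
  have := cospi_g0
  linarith

/-! ## §3 Assembly -/

/-- The phase budget for `α ≤ β`. [folklore] -/
theorem phaseBudget_of_le {α β : ℝ} (hα0 : 0 ≤ α) (hαβ : α ≤ β) (hβ : β ≤ 1 / 2) :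
    max (sawSigma α β) (sawSigma (1 - α) β) + max (sawSigma β α) (sawSigma (1 - β) α) ≤ sawSigmaStar := by
  have hσ0 : (0 : ℝ) ≤ sawSigmaStar := by norm_num [sawSigmaStar]
  have h1 : sawSigma α β = 0 := by
    rcases hα0.eq_or_lt with h | h
    · rw [← h]; simp [sawSigma]
    · exact sawSigma_eq_zero_of_le h hαβ hβ
  have hn1 : 0 ≤ sawSigma (1 - α) β := sawSigma_nonneg (by linarith) β
  have hn2 : 0 ≤ sawSigma β α := sawSigma_nonneg (hα0.trans hαβ) α
  have hn3 : 0 ≤ sawSigma (1 - β) α := sawSigma_nonneg (by linarith) α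
  rw [h1, max_eq_right hn1]
  have hV : max (sawSigma β α) (sawSigma (1 - β) α) ≤ sawSigmaStar :=
    max_le (sawSigma_le_sawSigmaStar _ _) (sawSigma_le_sawSigmaStar _ _)
  rcases le_or_gt α (1 / 4) with hq | hq
  · rw [sigma_wrapped_eq_zero_of_le_quarter hα0 hq hαβ hβ, zero_add]; exact hV
  · by_cases hpos : 0 < sawSigma β α
    · rw [sigma_wrapped_eq_zero_of_unwrapped_pos hq.le (hαβ.trans hβ) (hq.le.trans hαβ) hβ hpos, zero_add]
      exact hV
    · have h0 : sawSigma β α = 0 := le_antisymm (not_lt.1 hpos) hn2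
      rw [h0, max_eq_right hn3]
      exact ww_bound hq.le (hαβ.trans hβ) (hq.le.trans hαβ) hβ

/-- **PHASE BUDGET LEMMA (S1 of the K2 line `bellman-weight`).** For every lattice class `(α, β) ∈ [0, ½]²`:
`σ_H(α,β) + σ_V(α,β) = max (σ(α,β)) (σ(1−α,β)) + max (σ(β,α)) (σ(1−β,α)) ≤ σ⋆ = 0.30982` — the modal Kelvin–Helmholtz rates of
the two slots of a phase sum to at most ONE maximal rate, class-free (planner p4 g14's `PhaseBudget`, there certified by ball arithmetic,
kit j319236). [cite: Drazin2002, §8.3 (8.36)–(8.38) and Exercise 8.10 (broken-line Rayleigh data behind `sawSigma`)] -/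
theorem phaseBudget : ∀ α ∈ Icc (0 : ℝ) (1 / 2), ∀ β ∈ Icc (0 : ℝ) (1 / 2),
    max (sawSigma α β) (sawSigma (1 - α) β) + max (sawSigma β α) (sawSigma (1 - β) α) ≤ sawSigmaStar := by
  intro α hα β hβ
  rcases le_total α β with h | h
  · exact phaseBudget_of_le hα.1 h hβ.2
  · rw [add_comm]
    exact phaseBudget_of_le hβ.1 h hα.2

/-- Exponential form consumed by a per-phase budget: for `γ ≥ 0` and every class `(α, β) ∈ [0, ½]²` the product of the two slots'
modal amplifications is at most ONE maximal e-folding set, `e^{γσ_H} · e^{γσ_V} ≤ e^{γσ⋆}`. [folklore] -/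
theorem exp_mul_exp_le_exp_sawSigmaStar {γ α β : ℝ} (hγ : 0 ≤ γ) (hα : α ∈ Icc (0 : ℝ) (1 / 2))
    (hβ : β ∈ Icc (0 : ℝ) (1 / 2)) :
    Real.exp (γ * max (sawSigma α β) (sawSigma (1 - α) β)) * Real.exp (γ * max (sawSigma β α) (sawSigma (1 - β) α)) ≤
      Real.exp (γ * sawSigmaStar) := by
  rw [← Real.exp_add, Real.exp_le_exp, ← mul_add]
  exact mul_le_mul_of_nonneg_left (phaseBudget α hα β hβ) hγ

end Summit.AnomalousDissipation.AnomalousDissipation.Theorems.SawtoothPulseCascade.K2PhaseBudget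

end
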